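/-
Copyright (c) 2026. All rights reserved.
Released under Apache 2.0 license as described in the file LICENSE.
-/
import Literature.NumberTheory.ComplexMultiplication.DegenerateCMTypesElementaryAbelianTwoGroup
import HarnessLib

/-!
# CM types on the elementary abelian group of order `16`: a type of rank `5` has a non-trivial STABILISER — so no
# primitive CM type of a multiquadratic CM field of degree `16` is degenerate

The tree's `DegenerateCMTypesElementaryAbelianTwoGroup` (seat p10 g37-#3; T. Kubota [Kubota1965] §4 Lemma 2, Parseval)
proves that a CM type `T` on `G ≅ (ℤ/2)⁴` (with respect to an involution `ρ`) has Kubota rank `9`, `5` or `2`, and that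
rank `2` means `T` is a coset of an index-`2` subgroup.  THIS FILE settles the middle value: **a rank-`5` type is a
union of cosets of a subgroup `{1, h}` of order `2`** (`h ≠ 1, ρ`), i.e. it is stabilised by a non-trivial translation
— on the field side (sequel in `Pohlmann1968/`): a rank-`5` CM type of a multiquadratic CM field `K` of degree `16` is
induced from a (nondegenerate) type of a triquadratic CM subfield, hence is NOT primitive, and every simple abelian
`8`-fold with complex multiplication by `K` is nondegenerate.

The argument (Fourier inversion on `G`, B. Dodson's "constant weight" circle of ideas [Dodson1984] §3.1.1):
`16·𝟙_T = Σ_χ Ŝ(χ) χ` with `Ŝ(χ) = Σ_{t ∈ T} χ(t)`; only the trivial character (`Ŝ = 8`) and the odd characters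
contribute (§1–§2).  If the rank is `5`, exactly four odd characters `χ₁, …, χ₄` survive, all `a_χ(T)` are even
(g37-#3), and Parseval `Σ_{odd} Ŝ(χ)² = 64` forces `Ŝ(χᵢ) = ±4` (§3).  If the `χᵢ` had no common kernel element
`h ≠ 1`, then `g ↦ (χᵢ(g))ᵢ` would be a bijection `G → {±1}⁴` and some `g` would give `16·𝟙_T(g) = 8 + 16 = 24` —
absurd; so there is `h ≠ 1` with `χᵢ(h) = 1` for all `i`, and then `𝟙_T(th) = 𝟙_T(t)` (§4).

* §1 `card_mul_indicator_eq_sum` (Fourier inversion of `𝟙_S` in exponent `2`).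
* §2 `card_mul_indicator_eq_card_add_sum_odd` (for a CM type only `χ = 1` and the odd characters contribute).
* §3 `card_filter_eq_two_or_six_of_typeRank_eq_five` (`|G| = 16`, rank `5`: every surviving odd character has
  `a_χ(T) ∈ {2, 6}`, i.e. `Ŝ(χ) = ±4`; exactly four survive, `card_survivors_eq_four_of_typeRank_eq_five`).
* §4 **`exists_ne_one_forall_mul_mem_iff_of_typeRank_eq_five`** — `|G| = 16`, exponent `2`, rank `5` ⟹ there is
  `h ∈ G`, `h ≠ 1`, `h ≠ ρ`, with `th ∈ T ⟺ t ∈ T` for all `t`; **`typeRank_eq_of_forall_stabilizer_trivial`** — a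
  type on `(ℤ/2)⁴` with trivial stabiliser has the full rank `9`.

HONEST SCOPE.  Order `16` only (the analogous statement fails to be this simple in order `32`); the printed sources
give the rank count (Kubota) and the weight criterion (Dodson), the stabiliser conclusion is derived here.  THEOREMS
ONLY: no definition, no named fact, no instance, no `sorry`.

## References

* [Kubota1965] T. Kubota, Trans. AMS 118 (1965), §4 Lemma 2 (held text, p. 119).
* [Dodson1984] B. Dodson, Trans. AMS 283 (1984), §3.1.1 Theorem (constant weight criterion) (held text, pp. 11–12).
* [Gordon1999HodgeAVSurvey] B. B. Gordon, 9.4.1 (Kubota rank via characters).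

## Provenance

Lane `lit-hodgefound` (Track 2, Layer A3), seat `lit-hodgefound-p10` generation 37, row g37-#11; neighbours cited by
name, nothing restated: `DegenerateCMTypesElementaryAbelianTwoGroup` (`ExponentTwo.sum_char_eq_card_sub_two_mul`,
`sum_char_eq_zero_iff_two_mul_card_filter_eq`, `sum_char_eq_zero_of_even`, `even_card_filter_of_typeRank_ne`,
`sum_odd_sq_eq_int`), `CMTypeRankCharacters` (`IsCMTypeWith.typeRank_eq_one_add_ncard_oddCharacters`),
`CMTypeElementaryTwoGroupOddWeights` (`character_apply_eq_one_or_of_mul_self`), Mathlib `AddChar.sum_apply_eq_ite`,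
`Finset.surj_on_of_inj_on_of_card_le`.
-/

open scoped BigOperators Classical

namespace Literature.NumberTheory.ComplexMultiplication

namespace CyclicCMType

namespace ExponentTwo

variable {G : Type*} [CommGroup G] [Fintype G] [DecidableEq G] {ρ : G} {T : Finset G}

/-! ## §0 Helpers -/

section Helpers

omit [Fintype G] [DecidableEq G] in
/-- `g·g = 1` in exponent `2`. [folklore] -/
private theorem mul_self_eq_one₁₆ (hexp : ∀ g : G, g ^ 2 = 1) (g : G) : g * g = 1 := by
  rw [← pow_two]; exact hexp g

omit [Fintype G] [DecidableEq G] in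
/-- `g⁻¹ = g` in exponent `2`. [folklore] -/
private theorem inv_eq_self₁₆ (hexp : ∀ g : G, g ^ 2 = 1) (g : G) : g⁻¹ = g :=
  inv_eq_of_mul_eq_one_right (mul_self_eq_one₁₆ hexp g)

omit [Fintype G] [DecidableEq G] in
/-- Characters of a group of exponent `2` are `±1`-valued. [cite: Kubota1965, §4 Lemma 2 (proof)] -/
private theorem char_eq_one_or₁₆ (hexp : ∀ g : G, g ^ 2 = 1) (χ : AddChar (Additive G) ℂ) (g : G) :
    χ (Additive.ofMul g) = 1 ∨ χ (Additive.ofMul g) = -1 :=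
  character_apply_eq_one_or_of_mul_self χ (mul_self_eq_one₁₆ hexp g)

omit [Fintype G] [DecidableEq G] in
/-- `χ(gh) = χ(g)χ(h)`. [folklore] -/
private theorem char_mul₁₆ (χ : AddChar (Additive G) ℂ) (g h : G) :
    χ (Additive.ofMul (g * h)) = χ (Additive.ofMul g) * χ (Additive.ofMul h) := by
  rw [ofMul_mul, AddChar.map_add_eq_mul]

/-- Dual orthogonality: `Σ_χ χ(x) = |G|·[x = 1]` (Mathlib `AddChar.sum_apply_eq_ite`). [folklore] -/
private theorem sum_char_apply_eq_ite₁₆ (x : G) :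
    ∑ χ : AddChar (Additive G) ℂ, χ (Additive.ofMul x) = if x = 1 then (Fintype.card G : ℂ) else 0 := by
  have h := AddChar.sum_apply_eq_ite (α := Additive G) (Additive.ofMul x)
  have hc : Fintype.card (Additive G) = Fintype.card G := Fintype.card_congr Additive.toMul
  rw [h, hc]
  rfl

omit [Fintype G] [DecidableEq G] in
/-- `ρ² = 1`. [folklore] -/
private theorem rho_mul_rho₁₆ (h : IsCMTypeWith ρ (T : Set G)) : ρ * ρ = 1 := by
  have := h.invol (1 : G)
  simpa [smul_eq_mul] using this

omit [Fintype G] [DecidableEq G] in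
/-- `ρx ∈ T ⟺ x ∉ T`. [folklore] -/
private theorem rho_mul_mem_iff₁₆ (h : IsCMTypeWith ρ (T : Set G)) (x : G) : ρ * x ∈ T ↔ x ∉ T := by
  have := h.rho_smul_mem_iff x
  simpa only [smul_eq_mul, Finset.mem_coe] using this

/-- `2|T| = |G|`. [folklore] -/
private theorem two_mul_card₁₆ (h : IsCMTypeWith ρ (T : Set G)) : 2 * T.card = Fintype.card G := by
  have hinj : Function.Injective fun s : G => ρ * s := fun a b hab => mul_left_cancel hab
  have hc : Tᶜ = T.image fun s => ρ * s := by
    ext x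
    rw [Finset.mem_compl, Finset.mem_image]
    constructor
    · intro hx
      refine ⟨ρ * x, (rho_mul_mem_iff₁₆ h x).2 hx, ?_⟩
      show ρ * (ρ * x) = x
      rw [← mul_assoc, rho_mul_rho₁₆ h, one_mul]
    · rintro ⟨s, hs, rfl⟩
      exact fun hx => ((rho_mul_mem_iff₁₆ h s).1 hx) hs
  have h1 : Tᶜ.card = T.card := by rw [hc, Finset.card_image_of_injective _ hinj]
  have h2 := Finset.card_add_card_compl T
  omega

omit [DecidableEq G] in
/-- The set of surviving odd characters as a finset. [cite: Kubota1965, §4 Lemma 2] -/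
private theorem ncard_odd_nonvanishing_eq₁₆ (T : Finset G) (ρ : G) :
    {χ : AddChar (Additive G) ℂ | χ (Additive.ofMul ρ) = -1 ∧ ∑ s ∈ T, χ (Additive.ofMul s) ≠ 0}.ncard =
      ((Finset.univ.filter fun χ : AddChar (Additive G) ℂ => χ (Additive.ofMul ρ) = -1).filter
        fun χ => ∑ s ∈ T, χ (Additive.ofMul s) ≠ 0).card := by
  rw [← Set.ncard_coe_finset]
  congr 1
  ext χ
  simp only [Set.mem_setOf_eq, Finset.coe_filter, Finset.mem_filter, Finset.mem_univ, true_and]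

end Helpers

/-! ## §1 Fourier inversion of an indicator in exponent `2` -/

section Inversion

/-- **`|G|·𝟙_S(g) = Σ_χ Ŝ(χ)·χ(g)`** with `Ŝ(χ) = Σ_{s ∈ S} χ(s)`, for a group of exponent `2` (characters are real,
`χ(s)χ(g) = χ(sg)` and `Σ_χ χ(sg) = |G|·[s = g]`). [cite: Dodson1984, §3.1.1 Theorem (proof)] -/
theorem card_mul_indicator_eq_sum (hexp : ∀ g : G, g ^ 2 = 1) (S : Finset G) (g : G) :
    (if g ∈ S then (Fintype.card G : ℂ) else 0) =
      ∑ χ : AddChar (Additive G) ℂ, (∑ s ∈ S, χ (Additive.ofMul s)) * χ (Additive.ofMul g) := by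
  symm
  calc ∑ χ : AddChar (Additive G) ℂ, (∑ s ∈ S, χ (Additive.ofMul s)) * χ (Additive.ofMul g)
      = ∑ χ : AddChar (Additive G) ℂ, ∑ s ∈ S, χ (Additive.ofMul (s * g)) := by
        refine Finset.sum_congr rfl fun χ _ => ?_
        rw [Finset.sum_mul]
        exact Finset.sum_congr rfl fun s _ => (char_mul₁₆ χ s g).symm
    _ = ∑ s ∈ S, ∑ χ : AddChar (Additive G) ℂ, χ (Additive.ofMul (s * g)) := Finset.sum_comm
    _ = ∑ s ∈ S, (if s = g then (Fintype.card G : ℂ) else 0) := by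
        refine Finset.sum_congr rfl fun s _ => ?_
        rw [sum_char_apply_eq_ite₁₆]
        have hiff : s * g = 1 ↔ s = g := by
          constructor
          · intro h1
            rw [← inv_eq_self₁₆ hexp g]
            exact eq_inv_of_mul_eq_one_left h1
          · intro h1
            rw [h1]
            exact mul_self_eq_one₁₆ hexp g
        simp only [hiff]
    _ = if g ∈ S then (Fintype.card G : ℂ) else 0 := by rw [Finset.sum_ite_eq']

end Inversion

/-! ## §2 For a CM type only the trivial and the odd characters contribute -/

section CMType

/-- **`|G|·𝟙_T(g) = |T| + Σ_{χ odd} Ŝ(χ)·χ(g)`** for a CM type `T` (even non-trivial characters vanish on `T`, tree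
`sum_char_eq_zero_of_even`; the trivial character contributes `|T|`). [cite: Kubota1965, §4 Lemma 2]
[cite: Dodson1984, §3.1.1 Theorem (proof)] -/
theorem card_mul_indicator_eq_card_add_sum_odd (hexp : ∀ g : G, g ^ 2 = 1) (h : IsCMTypeWith ρ (T : Set G))
    (g : G) :
    (if g ∈ T then (Fintype.card G : ℂ) else 0) = (T.card : ℂ) +
      ∑ χ ∈ Finset.univ.filter (fun χ : AddChar (Additive G) ℂ => χ (Additive.ofMul ρ) = -1),
        (∑ s ∈ T, χ (Additive.ofMul s)) * χ (Additive.ofMul g) := by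
  rw [card_mul_indicator_eq_sum hexp T g, add_comm,
    ← Finset.sum_filter_add_sum_filter_not Finset.univ
      (fun χ : AddChar (Additive G) ℂ => χ (Additive.ofMul ρ) = -1)]
  congr 1
  have hρ2 : ρ * ρ = 1 := rho_mul_rho₁₆ h
  have h0mem : (0 : AddChar (Additive G) ℂ) ∈
      Finset.univ.filter (fun χ : AddChar (Additive G) ℂ => ¬ χ (Additive.ofMul ρ) = -1) := by
    rw [Finset.mem_filter, AddChar.zero_apply]
    exact ⟨Finset.mem_univ _, by norm_num⟩
  rw [Finset.sum_eq_single_of_mem (0 : AddChar (Additive G) ℂ) h0mem]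
  · simp only [AddChar.zero_apply, Finset.sum_const, nsmul_eq_mul, mul_one]
  · intro χ hχ hne
    have hχρ : χ (Additive.ofMul ρ) = 1 :=
      (character_apply_eq_one_or_of_mul_self χ hρ2).resolve_right (Finset.mem_filter.1 hχ).2
    rw [sum_char_eq_zero_of_even h hχρ hne, zero_mul]

end CMType

/-! ## §3 Order `16`, rank `5`: the four surviving odd characters have `Ŝ(χ) = ±4` -/

section Sixteen

/-- **Order `16`, rank `5`: exactly FOUR odd characters survive.** [cite: Kubota1965, §4 Lemma 2] -/
theorem card_survivors_eq_four_of_typeRank_eq_five (h : IsCMTypeWith ρ (T : Set G))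
    (hr : typeRank G (T : Set G) = 5) :
    ((Finset.univ.filter fun χ : AddChar (Additive G) ℂ => χ (Additive.ofMul ρ) = -1).filter
        fun χ => ∑ s ∈ T, χ (Additive.ofMul s) ≠ 0).card = 4 := by
  have hrank := h.typeRank_eq_one_add_ncard_oddCharacters
  rw [ncard_odd_nonvanishing_eq₁₆, hr] at hrank
  omega

/-- **Order `16`, rank `5`: every surviving odd character has `a_χ(T) ∈ {2, 6}`, i.e. `Ŝ(χ) = 8 − 2a_χ = ±4`** (all
`a_χ` are even since the rank is not `9`; Parseval `Σ_{odd} Ŝ² = 64` over the four survivors with each `Ŝ² ≥ 16`).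
[cite: Kubota1965, §4 Lemma 2] -/
theorem card_filter_eq_two_or_six_of_typeRank_eq_five (hexp : ∀ g : G, g ^ 2 = 1) (h : IsCMTypeWith ρ (T : Set G))
    (h16 : Fintype.card G = 16) (hr : typeRank G (T : Set G) = 5) {χ : AddChar (Additive G) ℂ}
    (hχ : χ (Additive.ofMul ρ) = -1) (hne : ∑ s ∈ T, χ (Additive.ofMul s) ≠ 0) :
    (T.filter fun s => χ (Additive.ofMul s) = -1).card = 2 ∨ (T.filter fun s => χ (Additive.ofMul s) = -1).card = 6 := by
  have hT : T.card = 8 := by have := two_mul_card₁₆ h; omega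
  set O := Finset.univ.filter (fun χ : AddChar (Additive G) ℂ => χ (Additive.ofMul ρ) = -1) with hO
  set surv := O.filter (fun χ => ∑ s ∈ T, χ (Additive.ofMul s) ≠ 0) with hsurv
  set k : AddChar (Additive G) ℂ → ℕ := fun ψ => (T.filter fun s => ψ (Additive.ofMul s) = -1).card with hk
  have h4 : surv.card = 4 := card_survivors_eq_four_of_typeRank_eq_five h hr
  -- all `k` even (rank `≠ 9`)
  have heven : ∀ ψ : AddChar (Additive G) ℂ, ψ (Additive.ofMul ρ) = -1 → Even (k ψ) := fun ψ hψ =>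
    even_card_filter_of_typeRank_ne hexp h (by rw [h16]; norm_num) (by rw [hr, h16]; norm_num) hψ
  -- `k ψ = 4 ⟺ Ŝ(ψ) = 0`
  have hk4 : ∀ ψ : AddChar (Additive G) ℂ, ∑ s ∈ T, ψ (Additive.ofMul s) = 0 ↔ k ψ = 4 := fun ψ => by
    rw [sum_char_eq_zero_iff_two_mul_card_filter_eq hexp ψ T, hT]
    simp only [hk]
    omega
  have hkle : ∀ ψ : AddChar (Additive G) ℂ, k ψ ≤ 8 := fun ψ => by
    simp only [hk]; rw [← hT]; exact Finset.card_filter_le _ _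
  -- Parseval over the survivors
  have hP0 : ∑ ψ ∈ O, ((T.card : ℤ) - 2 * (k ψ : ℤ)) ^ 2 = (T.card : ℤ) ^ 2 := sum_odd_sq_eq_int hexp h
  have hP : ∑ ψ ∈ O, ((8 : ℤ) - 2 * (k ψ : ℤ)) ^ 2 = 64 := by
    rw [hT] at hP0
    push_cast at hP0
    linarith
  have hPs : ∑ ψ ∈ surv, ((8 : ℤ) - 2 * (k ψ : ℤ)) ^ 2 = 64 := by
    rw [← hP, hsurv, ← Finset.sum_filter_add_sum_filter_not O (fun ψ => ∑ s ∈ T, ψ (Additive.ofMul s) ≠ 0)]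
    rw [Finset.sum_eq_zero (s := O.filter fun ψ => ¬ ∑ s ∈ T, ψ (Additive.ofMul s) ≠ 0) fun ψ hψ => ?_, add_zero]
    have h0 : k ψ = 4 := (hk4 ψ).1 (not_not.1 (Finset.mem_filter.1 hψ).2)
    rw [h0]; norm_num
  have hge : ∀ ψ ∈ surv, (16 : ℤ) ≤ ((8 : ℤ) - 2 * (k ψ : ℤ)) ^ 2 := by
    intro ψ hψ
    have hψO : ψ (Additive.ofMul ρ) = -1 := (Finset.mem_filter.1 (Finset.mem_filter.1 hψ).1).2
    have hψne : k ψ ≠ 4 := fun h4' => (Finset.mem_filter.1 hψ).2 ((hk4 ψ).2 h4')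
    obtain ⟨j, hj⟩ := heven ψ hψO
    have hcases : k ψ = 0 ∨ k ψ = 2 ∨ k ψ = 6 ∨ k ψ = 8 := by have := hkle ψ; omega
    rcases hcases with h0 | h0 | h0 | h0 <;> rw [h0] <;> norm_num
  have hzero : ∀ ψ ∈ surv, ((8 : ℤ) - 2 * (k ψ : ℤ)) ^ 2 - 16 = 0 := by
    refine (Finset.sum_eq_zero_iff_of_nonneg fun ψ hψ => sub_nonneg.2 (hge ψ hψ)).1 ?_
    rw [Finset.sum_sub_distrib, hPs, Finset.sum_const, h4]
    norm_num
  have hχs : χ ∈ surv := by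
    rw [hsurv, Finset.mem_filter, hO, Finset.mem_filter]
    exact ⟨⟨Finset.mem_univ _, hχ⟩, hne⟩
  have hsq : ((8 : ℤ) - 2 * (k χ : ℤ)) ^ 2 = 4 ^ 2 := by have := hzero χ hχs; linarith
  rcases abs_eq_abs.1 ((sq_eq_sq_iff_abs_eq_abs _ _).1 hsq) with h1 | h1
  · left; simp only [hk] at h1; omega
  · right; simp only [hk] at h1; omega

/-- **Order `16`, rank `5`: `Ŝ(χ)·χ(g)` summed over the odd characters is a sum of FOUR terms `±4`.**  Auxiliary form:
for `g` with `χ(g) = 1` for all survivors, `𝟙_T(tg) = 𝟙_T(t)`. [cite: Kubota1965, §4 Lemma 2] [cite: Dodson1984, §3.1.1 Theorem] -/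
theorem mul_mem_iff_of_forall_survivor_eq_one (hexp : ∀ g : G, g ^ 2 = 1) (h : IsCMTypeWith ρ (T : Set G))
    {g : G} (hg : ∀ χ : AddChar (Additive G) ℂ, χ (Additive.ofMul ρ) = -1 → ∑ s ∈ T, χ (Additive.ofMul s) ≠ 0 →
      χ (Additive.ofMul g) = 1) (t : G) : t * g ∈ T ↔ t ∈ T := by
  have key : ∀ u : G, (if u * g ∈ T then (Fintype.card G : ℂ) else 0) =
      if u ∈ T then (Fintype.card G : ℂ) else 0 := by
    intro u
    rw [card_mul_indicator_eq_card_add_sum_odd hexp h (u * g), card_mul_indicator_eq_card_add_sum_odd hexp h u]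
    congr 1
    refine Finset.sum_congr rfl fun χ hχ => ?_
    have hχρ : χ (Additive.ofMul ρ) = -1 := (Finset.mem_filter.1 hχ).2
    by_cases hS : ∑ s ∈ T, χ (Additive.ofMul s) = 0
    · rw [hS, zero_mul, zero_mul]
    · rw [char_mul₁₆, hg χ hχρ hS, mul_one]
  have hpos : (Fintype.card G : ℂ) ≠ 0 := by
    have : 0 < Fintype.card G := Fintype.card_pos
    exact_mod_cast this.ne'
  have k := key t
  constructor
  · intro htg
    by_contra ht
    rw [if_pos htg, if_neg ht] at k
    exact hpos k
  · intro ht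
    by_contra htg
    rw [if_neg htg, if_pos ht] at k
    exact hpos k.symm

/-- **ORDER `16`, RANK `5` ⟹ A NON-TRIVIAL STABILISER**: for `G` of exponent `2` and order `16` and a CM type `T`
(w.r.t. `ρ`) of Kubota rank `5`, there is `h ∈ G`, `h ≠ 1`, `h ≠ ρ`, with `th ∈ T ⟺ t ∈ T` for every `t` — `T` is a
union of cosets of `{1, h}` (on the field side: induced from the octic subfield `K^{⟨h⟩}`).  If the four surviving
odd characters had trivial common kernel, `g ↦ (χᵢ(g))` would be onto `{±1}⁴` and some `g` would make
`16·𝟙_T(g) = 8 + 4·4 = 24`. [cite: Kubota1965, §4 Lemma 2] [cite: Dodson1984, §3.1.1 Theorem] -/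
theorem exists_ne_one_forall_mul_mem_iff_of_typeRank_eq_five (hexp : ∀ g : G, g ^ 2 = 1)
    (h : IsCMTypeWith ρ (T : Set G)) (h16 : Fintype.card G = 16) (hr : typeRank G (T : Set G) = 5) :
    ∃ g : G, g ≠ 1 ∧ g ≠ ρ ∧ ∀ t : G, t * g ∈ T ↔ t ∈ T := by
  have hT : T.card = 8 := by have := two_mul_card₁₆ h; omega
  set O := Finset.univ.filter (fun χ : AddChar (Additive G) ℂ => χ (Additive.ofMul ρ) = -1) with hO
  set surv := O.filter (fun χ => ∑ s ∈ T, χ (Additive.ofMul s) ≠ 0) with hsurv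
  set k : AddChar (Additive G) ℂ → ℕ := fun ψ => (T.filter fun s => ψ (Additive.ofMul s) = -1).card with hk
  have h4 : surv.card = 4 := card_survivors_eq_four_of_typeRank_eq_five h hr
  have hmem_surv : ∀ χ : AddChar (Additive G) ℂ, χ ∈ surv ↔
      χ (Additive.ofMul ρ) = -1 ∧ ∑ s ∈ T, χ (Additive.ofMul s) ≠ 0 := fun χ => by
    rw [hsurv, Finset.mem_filter, hO, Finset.mem_filter]
    exact ⟨fun hh => ⟨hh.1.2, hh.2⟩, fun hh => ⟨⟨Finset.mem_univ _, hh.1⟩, hh.2⟩⟩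
  have hS : ∀ χ : AddChar (Additive G) ℂ, ∑ s ∈ T, χ (Additive.ofMul s) = (8 : ℂ) - 2 * (k χ : ℂ) := fun χ => by
    rw [sum_char_eq_card_sub_two_mul hexp χ T, hT]
    push_cast
    rfl
  have hk26 : ∀ χ ∈ surv, k χ = 2 ∨ k χ = 6 := fun χ hχ =>
    card_filter_eq_two_or_six_of_typeRank_eq_five hexp h h16 hr ((hmem_surv χ).1 hχ).1 ((hmem_surv χ).1 hχ).2
  -- Step 1: a non-trivial common kernel element of the survivors
  have hker : ∃ g : G, g ≠ 1 ∧ ∀ χ ∈ surv, χ (Additive.ofMul g) = 1 := by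
    by_contra hno
    have hno' : ∀ g : G, g ≠ 1 → ∃ χ ∈ surv, χ (Additive.ofMul g) = -1 := by
      intro g hg
      by_contra hall
      exact hno ⟨g, hg, fun χ hχ => (char_eq_one_or₁₆ hexp χ g).resolve_right fun h1 => hall ⟨χ, hχ, h1⟩⟩
    -- the sign pattern `g ↦ {χ ∈ surv : χ(g) = −1}` is injective, hence onto the power set of `surv`
    have hinj : ∀ g₁ g₂ : G, (surv.filter fun χ => χ (Additive.ofMul g₁) = -1) =
        (surv.filter fun χ => χ (Additive.ofMul g₂) = -1) → g₁ = g₂ := by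
      intro g₁ g₂ hfg
      by_contra hne
      have hne1 : g₁ * g₂ ≠ 1 := fun h1 =>
        hne (by rw [← inv_eq_self₁₆ hexp g₂]; exact eq_inv_of_mul_eq_one_left h1)
      obtain ⟨χ, hχs, hχv⟩ := hno' _ hne1
      have h1 := Finset.ext_iff.1 hfg χ
      have hiff : χ (Additive.ofMul g₁) = -1 ↔ χ (Additive.ofMul g₂) = -1 :=
        ⟨fun hh => (Finset.mem_filter.1 (h1.1 (Finset.mem_filter.2 ⟨hχs, hh⟩))).2,
          fun hh => (Finset.mem_filter.1 (h1.2 (Finset.mem_filter.2 ⟨hχs, hh⟩))).2⟩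
      rw [char_mul₁₆] at hχv
      rcases char_eq_one_or₁₆ hexp χ g₁ with h1 | h1 <;> rcases char_eq_one_or₁₆ hexp χ g₂ with h2 | h2
      · rw [h1, h2] at hχv; norm_num at hχv
      · exact absurd (hiff.2 h2) (by rw [h1]; norm_num)
      · exact absurd (hiff.1 h1) (by rw [h2]; norm_num)
      · rw [h1, h2] at hχv; norm_num at hχv
    have hcard : surv.powerset.card ≤ (Finset.univ : Finset G).card := by
      rw [Finset.card_powerset, h4, Finset.card_univ, h16]
      norm_num
    have hsurj : ∀ b ∈ surv.powerset, ∃ g : G, b = surv.filter fun χ => χ (Additive.ofMul g) = -1 := by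
      intro b hb
      obtain ⟨g, -, hg⟩ := Finset.surj_on_of_inj_on_of_card_le (s := (Finset.univ : Finset G))
        (t := surv.powerset) (fun a _ => surv.filter fun χ => χ (Additive.ofMul a) = -1)
        (fun a _ => Finset.mem_powerset.2 (Finset.filter_subset _ _))
        (fun g₁ g₂ _ _ hfg => hinj g₁ g₂ hfg) hcard b hb
      exact ⟨g, hg⟩
    obtain ⟨g, hg⟩ := hsurj (surv.filter fun χ => k χ = 6) (Finset.mem_powerset.2 (Finset.filter_subset _ _))
    have hsign : ∀ χ ∈ surv, k χ = 6 ↔ χ (Additive.ofMul g) = -1 := fun χ hχ => by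
      have h1 := Finset.ext_iff.1 hg χ
      exact ⟨fun hh => (Finset.mem_filter.1 (h1.1 (Finset.mem_filter.2 ⟨hχ, hh⟩))).2,
        fun hh => (Finset.mem_filter.1 (h1.2 (Finset.mem_filter.2 ⟨hχ, hh⟩))).2⟩
    -- at this `g`: `Σ_{odd} Ŝ(χ)χ(g) = 16`, so `16·𝟙_T(g) = 24`
    have hterm : ∀ χ ∈ surv, (∑ s ∈ T, χ (Additive.ofMul s)) * χ (Additive.ofMul g) = 4 := by
      intro χ hχ
      rw [hS χ]
      rcases hk26 χ hχ with h2 | h6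
      · have hg1 : χ (Additive.ofMul g) = 1 :=
          (char_eq_one_or₁₆ hexp χ g).resolve_right fun hm => by
            have := (hsign χ hχ).2 hm; omega
        rw [h2, hg1]; norm_num
      · rw [h6, (hsign χ hχ).1 h6]; norm_num
    have hsumO : ∑ χ ∈ O, (∑ s ∈ T, χ (Additive.ofMul s)) * χ (Additive.ofMul g) = 16 := by
      rw [← Finset.sum_filter_add_sum_filter_not O (fun χ => ∑ s ∈ T, χ (Additive.ofMul s) ≠ 0)]
      rw [Finset.sum_eq_zero (s := O.filter fun χ => ¬ ∑ s ∈ T, χ (Additive.ofMul s) ≠ 0) fun χ hχ => by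
        rw [not_not.1 (Finset.mem_filter.1 hχ).2, zero_mul], add_zero]
      rw [Finset.sum_congr rfl hterm, Finset.sum_const, h4]
      norm_num
    have hinv := card_mul_indicator_eq_card_add_sum_odd hexp h g
    rw [hsumO, hT, h16] at hinv
    split_ifs at hinv <;> norm_num at hinv
  -- Step 2: such an element stabilises `T`
  obtain ⟨g, hg1, hgχ⟩ := hker
  have hstab : ∀ t : G, t * g ∈ T ↔ t ∈ T :=
    mul_mem_iff_of_forall_survivor_eq_one hexp h (fun χ hχ hne => hgχ χ ((hmem_surv χ).2 ⟨hχ, hne⟩))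
  refine ⟨g, hg1, fun hgρ => ?_, hstab⟩
  obtain ⟨t, ht⟩ : T.Nonempty := by rw [← Finset.card_pos, hT]; norm_num
  have h1 := (hstab t).2 ht
  rw [hgρ, mul_comm, rho_mul_mem_iff₁₆ h t] at h1
  exact h1 ht

/-- **ORDER `16`: A CM TYPE WITH TRIVIAL STABILISER HAS THE FULL RANK `9`** (ranks are `9, 5, 2`; rank `5` has a
stabiliser of order `≥ 2` by the previous theorem, rank `2` is a coset of an index-`2` subgroup).
[cite: Kubota1965, §4 Lemma 2] [cite: Dodson1984, §3.1.1 Theorem] -/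
theorem typeRank_eq_nine_of_forall_exists_mul (hexp : ∀ g : G, g ^ 2 = 1) (h : IsCMTypeWith ρ (T : Set G))
    (h16 : Fintype.card G = 16) (hfree : ∀ g : G, g ≠ 1 → ∃ t : G, ¬ (t * g ∈ T ↔ t ∈ T)) :
    typeRank G (T : Set G) = 9 := by
  rcases typeRank_mem_of_card_sixteen hexp h h16 with h9 | h5 | h2
  · exact h9
  · obtain ⟨g, hg1, -, hstab⟩ := exists_ne_one_forall_mul_mem_iff_of_typeRank_eq_five hexp h h16 h5
    obtain ⟨t, ht⟩ := hfree g hg1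
    exact absurd (hstab t) ht
  · -- rank `2`: `T` is a coset of an index-`2` subgroup `H ∌ ρ`; any `1 ≠ g ∈ H` stabilises `T`
    obtain ⟨H, -, hidx, hTH⟩ := (typeRank_eq_two_iff_exists_subgroup hexp h).1 h2
    have hHne : H ≠ ⊥ := fun hb => by
      rw [hb, Subgroup.index_bot, Nat.card_eq_fintype_card, h16] at hidx
      omega
    obtain ⟨⟨g, hgH⟩, hg1⟩ := Subgroup.ne_bot_iff_exists_ne_one.1 hHne
    have hg1' : g ≠ 1 := fun h1 => hg1 (Subtype.ext h1)
    obtain ⟨t, ht⟩ := hfree g hg1'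
    refine absurd ?_ ht
    have hmemH : ∀ u : G, u * g ∈ H ↔ u ∈ H := fun u =>
      ⟨fun hu => by simpa using H.mul_mem hu (H.inv_mem hgH), fun hu => H.mul_mem hu hgH⟩
    rcases hTH with hTH | hTH
    · have hiff : ∀ u : G, u ∈ T ↔ u ∈ H := fun u => by
        rw [← Finset.mem_coe, hTH, SetLike.mem_coe]
      rw [hiff, hiff, hmemH]
    · have hiff : ∀ u : G, u ∈ T ↔ u ∉ H := fun u => by
        rw [← Finset.mem_coe, hTH, Set.mem_compl_iff, SetLike.mem_coe]
      rw [hiff, hiff, hmemH]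

end Sixteen

end ExponentTwo

end CyclicCMType

end Literature.NumberTheory.ComplexMultiplication
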